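import Literature.NumberTheory.GaloisRepresentations.LocalLayerInvariantBaseTransport
import Literature.NumberTheory.GaloisRepresentations.IdeleLocalInvariantsCanonical
import Literature.Algebra.Homology.SubgroupCohomologyConjugation
import HarnessLib

/-!
# The idèle local invariants under conjugation in a tower `F ⊆ K ⊆ E`:
# `inv_w(σ_t c) = inv_{t⁻¹w}(c)` on `H²(Gal(E/K), J_E)` for `t ∈ Gal(E/F)` (Tate, C–F VII §1.1, §7.2–7.3; Serre VII §5)

Topic `NumberTheory/GaloisRepresentations`; namespace `Literature.NumberTheory.GaloisRepresentations.IdeleCohomology`,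
continuing `IdeleLocalInvariants*.lean` (`localInvAt w`, `localInv E v`: THE local invariant of a class of `H²(Gal(E/K), J_E)`
at a finite place `v` of `K`, read at a place `w ∣ v` through the semi-local Shapiro isomorphism and door-c6's `layerInv`).
Definitions with bodies (the conjugation maps) and theorems; NO named fact, no `sorry`, no instance, no notation; number
fields in `Type`.  Lane «TATE-EPC-TC» of cell `bsd-eis` (crux `GoodLatticeBDPValue`, stmt-BirchSwinnertonDyer-19032),
piece (θ-ii) of the `hH2` gap: the local invariants of `𝓗²(E_S)[p]` are `Δ`-EQUIVARIANT.

Mathematics.  For a tower `F ⊆ K ⊆ E` of number fields with `E/F` Galois and `K/F` normal, an element `t ∈ Gal(E/F)`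
normalises `Gal(E/K)` and acts on `Hⁿ(Gal(E/K), J_E)` by Serre's `σ_t = Hⁿ(g ↦ t⁻¹ g t, x ↦ t x)` (the tree's
`subgroupConj`/`resConj` convention; `ideleConj`).  On idèles `(t x)_w = t_{w₀}(x_{w₀})` for `t w₀ = w` (Tate VII §1.1),
`t` carries the decomposition group of `w₀` onto that of `w`, and the Shapiro isomorphism at `w` reads `σ_t c` as the
TRANSPORT of the reading of `c` at `w₀` along the pair of isomorphisms of completed layers
`(K_{v₀} ⥲ K_{v'}, E_{w₀} ⥲ E_w)` induced by `(t|_K, t)` (§3, `shapiro_placeProj_ideleConj`; a `map_congr'` identity, no inner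
automorphism needed).  Door-c6's local invariant is preserved by that transport
(`UnitsLayer.layerInv_layerTransport`, `LocalLayerInvariantBaseTransport.lean`: Serre XI §1 (iv) / [AbsAnab] 1.2.1 (vii)),
whence **`inv_w(σ_t c) = inv_{w₀}(c)`**, i.e. `localInv E v' (σ_t c) = localInv E ((t|_K)⁻¹ v') c` (§4).

## What is formalised (`F K E : Type`, `IsScalarTower F K E`)
§1 `galAdicCompletionMap_restrictScalars`, `under_algEquiv_smul_restrictNormal`, `galSmulPlace`; §2 **`galConjOver K t`**
(`g ↦ t⁻¹ g t` on `Gal(E/K)`), **`ideleConjHom`**, **`ideleConj F K E t n`** (`σ_t`); §3 `galAdicCompletionEquiv_algebraMap_place`,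
`decompAlgEquiv_galConjOver`, **`shapiro_placeProj_ideleConj`**; §4 **`localInvAt_ideleConj`**, **`localInv_ideleConj`**; §5 the
bridge to the tree's `conjRepCohomology N J_E` for a normal `N ≤ Gal(E/F)` identified with `Gal(E/K)`
(`resIdeleRepIsoOfEquiv`, `resIdeleRepIsoOfEquiv_conjRepCohomology`, **`localInv_conjRepCohomology`**).
HONEST FRAMING: functoriality bookkeeping of class field theory; no statement of a Summit, of Tate's theorem or of the crux is
proved here; 0 cells / labels / tiers move.

## References
* J. W. S. Cassels, A. Fröhlich (eds.), *Algebraic Number Theory* (1967), Ch. VII (Tate) §1.1, §7.2–7.3. [CasselsFrohlichANT1967]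
* J.-P. Serre, *Local Fields*, GTM 67 (1979), Ch. VII §5 Prop. 3, Ch. XI §1 (iv). [SerreLocalFields1979]
* K. S. Brown, *Cohomology of Groups*, GTM 87 (1982), III (8.3). [Brown1982CohomologyGroups]
-/

noncomputable section

open CategoryTheory groupCohomology Function NumberField IsDedekindDomain
open scoped Pointwise

namespace Literature.NumberTheory.GaloisRepresentations

namespace IdeleCohomology

open Literature.NumberTheory.Automorphic Literature.Algebra.Homology SemiLocal
open Literature.AlgebraicGeometry.Frobenioids.PadicKummer
open scoped ValuativeRel

/-! ## §1. Galois action on places and completions in a tower `F ⊆ K ⊆ E` -/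

section Tower

variable {F K E : Type} [Field F] [Field K] [Field E] [Algebra F K] [Algebra K E] [Algebra F E] [IsScalarTower F K E]

/-- **The transport of completions does not remember the base field**: for `g ∈ Gal(E/K)` the continuous extension
`E_w → E_{gw}` of `g` computed through `Gal(E/K)` or through `Gal(E/F)` (`g|_F`) is the same map (both extend `x ↦ g x`).
[cite: CasselsFrohlichANT1967, Ch. VII §1.1] -/
theorem galAdicCompletionMap_restrictScalars [NumberField E] (g : E ≃ₐ[K] E) {w w' : HeightOneSpectrum (𝓞 E)} (h : g • w = w')
    (h' : (AlgEquiv.restrictScalars F g) • w = w') (y : w.adicCompletion E) :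
    galAdicCompletionMap (AlgEquiv.restrictScalars F g) h' y = galAdicCompletionMap g h y := by
  refine congrFun (HeightOneSpectrum.adicCompletion.ext_of_coe (L := E) w (continuous_galAdicCompletionMap E _ h')
    (continuous_galAdicCompletionMap E _ h) fun x => ?_) y
  rw [galAdicCompletionMap_coe_algEquiv, galAdicCompletionMap_coe_algEquiv]; rfl

/-- `g • w` is the same place through `Gal(E/K)` or through `Gal(E/F)`. [cite: CasselsFrohlichANT1967, Ch. VII §1.1] -/
theorem restrictScalars_smul_place (g : E ≃ₐ[K] E) (w : HeightOneSpectrum (𝓞 E)) : (AlgEquiv.restrictScalars F g) • w = g • w := rfl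

variable [Normal F K]

/-- **`(t w) ∩ 𝓞 K = t|_K (w ∩ 𝓞 K)`**: a place of `E` and its `t`-conjugate lie over `t|_K`-conjugate places of the
normal intermediate field `K`. [cite: CasselsFrohlichANT1967, Ch. VII §1.1] -/
theorem under_algEquiv_smul_restrictNormal (t : E ≃ₐ[F] E) (w : HeightOneSpectrum (𝓞 E)) :
    (t • w).under (𝓞 K) = t.restrictNormal K • w.under (𝓞 K) := by
  apply HeightOneSpectrum.ext
  change Ideal.comap (algebraMap (𝓞 K) (𝓞 E)) (t • w.asIdeal) =
    t.restrictNormal K • Ideal.comap (algebraMap (𝓞 K) (𝓞 E)) w.asIdeal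
  ext x
  rw [Ideal.mem_comap, Ideal.mem_pointwise_smul_iff_inv_smul_mem, Ideal.mem_pointwise_smul_iff_inv_smul_mem,
    Ideal.mem_comap]
  -- `t⁻¹ (x) = (t|_K)⁻¹ x` inside `𝓞 E`
  have key : t⁻¹ • algebraMap (𝓞 K) (𝓞 E) x = algebraMap (𝓞 K) (𝓞 E) ((t.restrictNormal K)⁻¹ • x) := by
    apply Subtype.ext
    change t⁻¹ (algebraMap K E (x : K)) = algebraMap K E (((t.restrictNormal K)⁻¹ • x : 𝓞 K) : K)
    rw [RingOfIntegers.coe_algEquiv_smul,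
      show (t.restrictNormal K)⁻¹ = t⁻¹.restrictNormal K from (map_inv (AlgEquiv.restrictNormalHom K) t).symm]
    exact (AlgEquiv.restrictNormal_commutes t⁻¹ K (x : K)).symm
  rw [key]

/-- **`t` carries a place of `E` above `v₀` to a place above `t|_K v₀`.** [cite: CasselsFrohlichANT1967, Ch. VII §1.1] -/
def galSmulPlace [NumberField K] [NumberField E] (t : E ≃ₐ[F] E) {v₀ v' : HeightOneSpectrum (𝓞 K)} (h₀ : t.restrictNormal K • v₀ = v')
    (w₀ : Place K E v₀) : Place K E v' :=
  ⟨t • (w₀ : HeightOneSpectrum (𝓞 E)), by rw [under_algEquiv_smul_restrictNormal, w₀.under_eq, h₀]⟩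

/-- Unfolding `galSmulPlace`. [cite: CasselsFrohlichANT1967, Ch. VII §1.1] -/
@[simp] theorem coe_galSmulPlace [NumberField K] [NumberField E] (t : E ≃ₐ[F] E) {v₀ v' : HeightOneSpectrum (𝓞 K)} (h₀ : t.restrictNormal K • v₀ = v')
    (w₀ : Place K E v₀) : ((galSmulPlace t h₀ w₀ : Place K E v') : HeightOneSpectrum (𝓞 E)) = t • (w₀ : HeightOneSpectrum (𝓞 E)) :=
  rfl

end Tower

/-! ## §2. Serre's `σ_t` on `Hⁿ(Gal(E/K), J_E)` for `t ∈ Gal(E/F)` -/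

section Conj

variable {F K E : Type} [Field F] [Field K] [Field E]
  [Algebra F K] [Algebra K E] [Algebra F E] [IsScalarTower F K E] [Normal F K]

variable (K) in
/-- **`g ↦ t⁻¹ g t` on `Gal(E/K)`** for `t ∈ Gal(E/F)` (`K/F` normal, so `t K = K` and `t⁻¹ g t` is again `K`-linear):
the group component of Serre's `σ_t`. [cite: SerreLocalFields1979, Ch. VII §5] -/
def galConjOver (t : E ≃ₐ[F] E) : (E ≃ₐ[K] E) →* (E ≃ₐ[K] E) where
  toFun g := AlgEquiv.ofRingEquiv (f := t.toRingEquiv.trans (g.toRingEquiv.trans t.symm.toRingEquiv)) fun y => by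
    change t.symm (g (t (algebraMap K E y))) = algebraMap K E y
    rw [← AlgEquiv.restrictNormal_commutes, AlgEquiv.commutes, AlgEquiv.restrictNormal_commutes,
      AlgEquiv.symm_apply_apply]
  map_one' := AlgEquiv.ext fun x => by
    change t.symm ((1 : E ≃ₐ[K] E) (t x)) = x
    rw [AlgEquiv.one_apply, AlgEquiv.symm_apply_apply]
  map_mul' g g' := AlgEquiv.ext fun x => by
    change t.symm ((g * g') (t x)) = t.symm (g (t (t.symm (g' (t x)))))
    rw [AlgEquiv.mul_apply, AlgEquiv.apply_symm_apply]

/-- `galConjOver K t g x = t⁻¹ (g (t x))`. [cite: SerreLocalFields1979, Ch. VII §5] -/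
@[simp] theorem galConjOver_apply (t : E ≃ₐ[F] E) (g : E ≃ₐ[K] E) (x : E) : galConjOver K t g x = t.symm (g (t x)) := rfl

/-- Through `Gal(E/F)`: `(t⁻¹ g t)|_F = t⁻¹ g|_F t`. [cite: SerreLocalFields1979, Ch. VII §5] -/
theorem restrictScalars_galConjOver (t : E ≃ₐ[F] E) (g : E ≃ₐ[K] E) :
    AlgEquiv.restrictScalars F (galConjOver K t g) = t⁻¹ * AlgEquiv.restrictScalars F g * t :=
  AlgEquiv.ext fun _ => rfl

variable [NumberField E]

variable (F K E) in
/-- **The module component `x ↦ t x` of `σ_t`**: `Res_{t⁻¹·t} J_E ⟶ J_E` as `Gal(E/K)`-modules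
(`t ((t⁻¹ g t) x) = g (t x)`). [cite: SerreLocalFields1979, Ch. VII §5] -/
def ideleConjHom (t : E ≃ₐ[F] E) :
    Rep.res (galConjOver K t) (IdeleClassGroup.ideleRep K E) ⟶ IdeleClassGroup.ideleRep K E :=
  Rep.ofHom ⟨(IdeleClassGroup.ideleRep F E).ρ t, fun g => LinearMap.ext fun x => by
    change (IdeleClassGroup.ideleRep F E).ρ t ((IdeleClassGroup.ideleRep F E).ρ
        (AlgEquiv.restrictScalars F (galConjOver K t g)) x) =
      (IdeleClassGroup.ideleRep F E).ρ (AlgEquiv.restrictScalars F g) ((IdeleClassGroup.ideleRep F E).ρ t x)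
    rw [← Module.End.mul_apply, ← map_mul, ← Module.End.mul_apply, ← map_mul, restrictScalars_galConjOver]
    congr 2
    group⟩

/-- Unfolding: `ideleConjHom` is `x ↦ t • x` on idèles. [cite: SerreLocalFields1979, Ch. VII §5] -/
theorem ideleConjHom_hom_apply (t : E ≃ₐ[F] E) (x : Additive (ideleGroup E)) :
    (ideleConjHom F K E t).hom x = Additive.ofMul (t • Additive.toMul x) := rfl

variable (F K E) in
/-- **Serre's `σ_t : Hⁿ(Gal(E/K), J_E) ⟶ Hⁿ(Gal(E/K), J_E)`** for `t ∈ Gal(E/F)`: `Hⁿ(g ↦ t⁻¹ g t, x ↦ t x)` (the tree's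
`subgroupConj`/`resConj` convention of `CoinducedConjugation` / `SubgroupCohomologyConjugation.conjRepCohomology`, on the
group `Gal(E/K)` rather than on a subgroup of `Gal(E/F)`). [cite: SerreLocalFields1979, Ch. VII §5][cite: Brown1982CohomologyGroups, III (8.3)] -/
def ideleConj (t : E ≃ₐ[F] E) (n : ℕ) :
    groupCohomology (IdeleClassGroup.ideleRep K E) n ⟶ groupCohomology (IdeleClassGroup.ideleRep K E) n :=
  groupCohomology.map (galConjOver K t) (ideleConjHom F K E t) n

end Conj

/-! ## §3. The semi-local Shapiro isomorphism reads `σ_t c` at `w = t w₀` as the transport of the reading of `c` at `w₀` -/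

section SemiLocal

variable {F K E : Type} [Field F] [Field K] [Field E] [NumberField K] [NumberField E]
  [Algebra F K] [Algebra K E] [Algebra F E] [IsScalarTower F K E] [Normal F K]
variable (t : E ≃ₐ[F] E) {v₀ v' : HeightOneSpectrum (𝓞 K)} (h₀ : t.restrictNormal K • v₀ = v')
  {w₀ : Place K E v₀} {w : Place K E v'} (ht : t • (w₀ : HeightOneSpectrum (𝓞 E)) = w)

omit [NumberField E] in
/-- `t|_K : K_{v₀} ⥲ K_{v'}` identifies the valuation rings (it preserves `Valued.v`). [cite: CasselsFrohlichANT1967, Ch. VII §1.1] -/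
theorem mem_integer_iff_galAdicCompletionEquiv_restrictNormal (x : v₀.adicCompletion K) :
    x ∈ 𝒪[v₀.adicCompletion K] ↔ galAdicCompletionEquiv (L := K) (t.restrictNormal K) h₀ x ∈ 𝒪[v'.adicCompletion K] := by
  have h1 : x ∈ 𝒪[v₀.adicCompletion K] ↔ Valued.v x ≤ 1 := by
    rw [Valuation.mem_integer_iff, ← (ValuativeRel.valuation (v₀.adicCompletion K)).map_one,
      ← Valuation.vle_iff_le, Valuation.vle_iff_le (Valued.v), map_one]
  have h2 : galAdicCompletionEquiv (L := K) (t.restrictNormal K) h₀ x ∈ 𝒪[v'.adicCompletion K] ↔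
      Valued.v (galAdicCompletionEquiv (L := K) (t.restrictNormal K) h₀ x) ≤ 1 := by
    rw [Valuation.mem_integer_iff, ← (ValuativeRel.valuation (v'.adicCompletion K)).map_one,
      ← Valuation.vle_iff_le, Valuation.vle_iff_le (Valued.v), map_one]
  rw [h1, h2, coe_galAdicCompletionEquiv, valued_galAdicCompletionMap]

include ht in
/-- **`t_{w₀} : E_{w₀} ⥲ E_w` lies over `(t|_K)_{v₀} : K_{v₀} ⥲ K_{v'}`** (both are continuous and agree on `K ⊆ K_{v₀}`).
[cite: CasselsFrohlichANT1967, Ch. VII §1.1] -/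
theorem galAdicCompletionEquiv_algebraMap_place (y : v₀.adicCompletion K) :
    galAdicCompletionEquiv (L := E) t ht
        (algebraMap (v₀.adicCompletion K) ((w₀ : HeightOneSpectrum (𝓞 E)).adicCompletion E) y) =
      algebraMap (v'.adicCompletion K) ((w : HeightOneSpectrum (𝓞 E)).adicCompletion E)
        (galAdicCompletionEquiv (L := K) (t.restrictNormal K) h₀ y) := by
  refine congrFun (HeightOneSpectrum.adicCompletion.ext_of_coe (L := K) v₀
    ((continuous_galAdicCompletionMap E t ht).comp
      (continuous_adicCompletionOfLiesOver K E v₀ (w₀ : HeightOneSpectrum (𝓞 E))))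
    ((continuous_adicCompletionOfLiesOver K E v' (w : HeightOneSpectrum (𝓞 E))).comp
      (continuous_galAdicCompletionMap K (t.restrictNormal K) h₀)) fun a => ?_) y
  change galAdicCompletionMap t ht (adicCompletionOfLiesOver K E v₀ (w₀ : HeightOneSpectrum (𝓞 E)) (a : v₀.adicCompletion K)) =
    adicCompletionOfLiesOver K E v' (w : HeightOneSpectrum (𝓞 E))
      (galAdicCompletionMap (t.restrictNormal K) h₀ (a : v₀.adicCompletion K))
  rw [adicCompletionOfLiesOver_coe, galAdicCompletionMap_coe_algEquiv, galAdicCompletionMap_coe_algEquiv,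
    adicCompletionOfLiesOver_coe, AlgEquiv.restrictNormal_commutes]

/-- **`t` conjugates the decomposition isomorphisms**: for `s` in the decomposition group of `w = t w₀` (in `Gal(E/K)`),
`(t⁻¹ s t)_{w₀} = t_{w₀}⁻¹ ∘ s_w ∘ t_{w₀}`, i.e. `decompAlgEquiv w₀ (t⁻¹ s t) = semiConj⁻¹ (decompAlgEquiv w s)` along the
pair `((t|_K)_{v₀}, t_{w₀})`. [cite: CasselsFrohlichANT1967, Ch. VII §1.1] -/
theorem decompAlgEquiv_galConjOver (s : MulAction.stabilizer (E ≃ₐ[K] E) w)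
    (hs : galConjOver K t (s : E ≃ₐ[K] E) ∈ MulAction.stabilizer (E ≃ₐ[K] E) w₀) :
    decompAlgEquiv w₀ ⟨galConjOver K t (s : E ≃ₐ[K] E), hs⟩ =
      (semiConj (galAdicCompletionEquiv (L := K) (t.restrictNormal K) h₀) (galAdicCompletionEquiv (L := E) t ht)
        (galAdicCompletionEquiv_algebraMap_place t h₀ ht)).symm (decompAlgEquiv w s) := by
  apply AlgEquiv.ext
  intro y
  rw [semiConj_symm_apply, decompAlgEquiv_apply, decompAlgEquiv_apply, galAdicCompletionEquiv_symm_apply,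
    coe_galAdicCompletionEquiv]
  -- everything through `Gal(E/F)` and the cocycle law of the transport maps
  rw [← galAdicCompletionMap_restrictScalars (F := F) (s : E ≃ₐ[K] E) (coe_stabilizer_smul w s)
      (coe_stabilizer_smul w s),
    ← galAdicCompletionMap_restrictScalars (F := F) (galConjOver K t (s : E ≃ₐ[K] E))
      (coe_stabilizer_smul w₀ ⟨_, hs⟩) (coe_stabilizer_smul w₀ ⟨_, hs⟩),
    galAdicCompletionMap_galAdicCompletionMap, galAdicCompletionMap_galAdicCompletionMap]
  exact galAdicCompletionMap_congr_left E (restrictScalars_galConjOver t (s : E ≃ₐ[K] E)) _ _ y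

include ht in
/-- The conjugate `t⁻¹ s t` of an element of the decomposition group of `w = t w₀` stabilises `w₀`.
[cite: CasselsFrohlichANT1967, Ch. VII §1.1] -/
theorem galConjOver_mem_stabilizer (s : MulAction.stabilizer (E ≃ₐ[K] E) w) :
    galConjOver K t (s : E ≃ₐ[K] E) ∈ MulAction.stabilizer (E ≃ₐ[K] E) w₀ := by
  rw [MulAction.mem_stabilizer_iff]
  apply Place.ext
  rw [Place.coe_smul, ← restrictScalars_smul_place (F := F), restrictScalars_galConjOver, mul_smul, mul_smul, ht,
    restrictScalars_smul_place, ← Place.coe_smul, MulAction.mem_stabilizer_iff.mp s.2, inv_smul_eq_iff]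
  exact ht.symm

variable [IsGalois F E]

/-- **The semi-local Shapiro isomorphism at `w = t w₀` reads `σ_t c` as the transport of the reading of `c` at `w₀`**:
`Sh_w (Hⁿ(placeProj v') (σ_t c)) = layerTransport ((t|_K)_{v₀}, t_{w₀}) (Sh_{w₀} (Hⁿ(placeProj v₀) c))`.  Both sides are
`Hⁿ` of ONE morphism of pairs `(Gal(E_w/K_{v'}), E_wˣ) → (Gal(E/K), J_E)`: on groups `s ↦ t⁻¹ s t` read through the
decomposition isomorphisms (`decompAlgEquiv_galConjOver`), on modules `x ↦ (t x)_w = t_{w₀}(x_{w₀})`.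
[cite: CasselsFrohlichANT1967, Ch. VII §1.1, §7.2][cite: Brown1982CohomologyGroups, III (8.3)] -/
theorem shapiro_placeProj_ideleConj (n : ℕ) (c : groupCohomology (IdeleClassGroup.ideleRep K E) n) :
    haveI : IsGalois K E := IsGalois.tower_top_of_isGalois F K E
    (groupCohomologyUnitsRepIsoAut w n).hom
        (groupCohomology.map (MonoidHom.id (E ≃ₐ[K] E)) (placeProj (F := K) (E := E) v') n (ideleConj F K E t n c)) =
      UnitsLayer.layerTransport (galAdicCompletionEquiv (L := K) (t.restrictNormal K) h₀)
        ((w₀ : HeightOneSpectrum (𝓞 E)).adicCompletion E) ((w : HeightOneSpectrum (𝓞 E)).adicCompletion E)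
        (galAdicCompletionEquiv (L := E) t ht) (galAdicCompletionEquiv_algebraMap_place t h₀ ht) n
        ((groupCohomologyUnitsRepIsoAut w₀ n).hom
          (groupCohomology.map (MonoidHom.id (E ≃ₐ[K] E)) (placeProj (F := K) (E := E) v₀) n c)) := by
  haveI : IsGalois K E := IsGalois.tower_top_of_isGalois F K E
  -- both sides as ONE `groupCohomology.map` applied to `c`
  have key : ideleConj F K E t n ≫ groupCohomology.map (MonoidHom.id (E ≃ₐ[K] E)) (placeProj (F := K) (E := E) v') n ≫
      (groupCohomologyUnitsRepIsoAut w n).hom =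
    groupCohomology.map (MonoidHom.id (E ≃ₐ[K] E)) (placeProj (F := K) (E := E) v₀) n ≫
      (groupCohomologyUnitsRepIsoAut w₀ n).hom ≫
      UnitsLayer.layerTransport (galAdicCompletionEquiv (L := K) (t.restrictNormal K) h₀)
        ((w₀ : HeightOneSpectrum (𝓞 E)).adicCompletion E) ((w : HeightOneSpectrum (𝓞 E)).adicCompletion E)
        (galAdicCompletionEquiv (L := E) t ht) (galAdicCompletionEquiv_algebraMap_place t h₀ ht) n := by
    rw [ideleConj, groupCohomologyUnitsRepIsoAut, groupCohomologyUnitsRepIsoAut, Iso.trans_hom, Iso.trans_hom,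
      groupCohomologyUnitsRepIso_hom_eq, groupCohomologyUnitsRepIso_hom_eq, groupCohomologyLocalUnitsRepIso,
      groupCohomologyLocalUnitsRepIso, groupCohomology.mapIso_hom, groupCohomology.mapIso_hom, UnitsLayer.layerTransport]
    simp only [← groupCohomology.map_comp]
    refine map_congr' ?_ _ _ (fun x => ?_) n
    · -- groups: `t⁻¹ s t` through the decomposition isomorphisms
      refine MonoidHom.ext fun s => ?_
      obtain ⟨s', rfl⟩ := (decompMulEquiv w).surjective s
      change galConjOver K t ((MulAction.stabilizer (E ≃ₐ[K] E) w).subtype ((decompMulEquiv w).symm (decompMulEquiv w s'))) =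
        (MulAction.stabilizer (E ≃ₐ[K] E) w₀).subtype ((decompMulEquiv w₀).symm
          ((semiConj (galAdicCompletionEquiv (L := K) (t.restrictNormal K) h₀) (galAdicCompletionEquiv (L := E) t ht)
            (galAdicCompletionEquiv_algebraMap_place t h₀ ht)).symm (decompMulEquiv w s')))
      rw [MulEquiv.symm_apply_apply, Subgroup.coe_subtype, Subgroup.coe_subtype, decompMulEquiv_apply,
        ← decompAlgEquiv_galConjOver t h₀ ht s' (galConjOver_mem_stabilizer t ht s'), ← decompMulEquiv_apply,
        MulEquiv.symm_apply_apply]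
    · -- modules: `(t x)_w = t_{w₀} (x_{w₀})`
      apply (Additive.toMul (α := ((w : HeightOneSpectrum (𝓞 E)).adicCompletion E)ˣ)).injective
      refine Units.ext ?_
      change ((IdeleHerbrand.blockHom K E v' (t • (Additive.toMul (x : Additive (ideleGroup E)) : ideleGroup E)) :
          (SemiLocal K E v')ˣ) : SemiLocal K E v') w =
        galAdicCompletionEquiv (L := E) t ht
          (((IdeleHerbrand.blockHom K E v₀ (Additive.toMul (x : Additive (ideleGroup E)) : ideleGroup E) :
            (SemiLocal K E v₀)ˣ) : SemiLocal K E v₀) w₀)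
      rw [IdeleHerbrand.blockHom_apply, IdeleHerbrand.blockHom_apply, IdeleHerbrand.snd_smul_apply,
        coe_galAdicCompletionEquiv]
      exact galAdicCompletionMap_apply_congr_place E (inv_smul_eq_iff.mpr ht.symm) _ _ _
  simpa only [ModuleCat.hom_comp, LinearMap.comp_apply] using congrArg (fun φ => φ.hom c) key

end SemiLocal

/-! ## §4. `inv_w(σ_t c) = inv_{w₀}(c)` and `localInv E v' (σ_t c) = localInv E ((t|_K)⁻¹ v') c` -/

section Main

variable {F K E : Type} [Field F] [Field K] [Field E] [NumberField K] [NumberField E]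
  [Algebra F K] [Algebra K E] [Algebra F E] [IsScalarTower F K E] [Normal F K] [IsGalois F E]
variable (t : E ≃ₐ[F] E) {v₀ v' : HeightOneSpectrum (𝓞 K)} (h₀ : t.restrictNormal K • v₀ = v')
  (w₀ : Place K E v₀) (w : Place K E v') (ht : t • (w₀ : HeightOneSpectrum (𝓞 E)) = w)

include h₀ ht in
/-- **THE local invariants of `H²(Gal(E/K), J_E)` are compatible with `σ_t`, `t ∈ Gal(E/F)`**: read at the places `w = t w₀`
and `w₀`, `inv_w(σ_t c) = inv_{w₀}(c)` — the Shapiro readings differ by the transport along `((t|_K)_{v₀}, t_{w₀})` (§3) and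
door-c6's `inv_{E_w/K_v}` is preserved by that transport (`UnitsLayer.layerInv_layerTransport`).
[cite: CasselsFrohlichANT1967, Ch. VII §1.1, §7.2–§7.3][cite: SerreLocalFields1979, Ch. XI §1 (iv)] -/
theorem localInvAt_ideleConj (c : groupCohomology (IdeleClassGroup.ideleRep K E) 2) :
    haveI : IsGalois K E := IsGalois.tower_top_of_isGalois F K E
    localInvAt w (ideleConj F K E t 2 c) = localInvAt w₀ c := by
  haveI : IsGalois K E := IsGalois.tower_top_of_isGalois F K E
  haveI : CharZero (v₀.adicCompletion K) := charZero_of_injective_algebraMap (algebraMap K _).injective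
  haveI : CharZero (v'.adicCompletion K) := charZero_of_injective_algebraMap (algebraMap K _).injective
  haveI := finiteDimensional_place (K := K) w₀
  haveI := finiteDimensional_place (K := K) w
  haveI := isGalois_place (F := K) w₀
  haveI := isGalois_place (F := K) w
  rw [localInvAt_apply, localInvAt_apply, shapiro_placeProj_ideleConj t h₀ ht]
  exact UnitsLayer.layerInv_layerTransport (galAdicCompletionEquiv (L := K) (t.restrictNormal K) h₀)
    (mem_integer_iff_galAdicCompletionEquiv_restrictNormal t h₀) _ _ (galAdicCompletionEquiv (L := E) t ht)
    (galAdicCompletionEquiv_algebraMap_place t h₀ ht) _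

omit h₀ w₀ w ht

/-- **`localInv E v' (σ_t c) = localInv E ((t|_K)⁻¹ v') c`**: THE local invariant of `σ_t c` at a finite place `v'` of `K` is
the local invariant of `c` at the conjugate place `(t|_K)⁻¹ v'` (`localInv` may be read at any place above,
`localInv_eq_localInvAt`; take `w₀ ∣ (t|_K)⁻¹ v'` and `w = t w₀ ∣ v'`).  LANE DICTIONARY («TATE-EPC-TC», `hH2`): with
`F := F₀`, `K := E` (the `Δ`-layer), `E := E'` a deeper layer and `t` a lift of `d ∈ Δ`, the invariant vector
`θ_{E'}(c) = (inv_v(ι c))_v` satisfies `θ_{E'}(σ_t c) = d · θ_{E'}(c)`.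
[cite: CasselsFrohlichANT1967, Ch. VII §1.1, §7.2–§7.3][cite: SerreLocalFields1979, Ch. VII §5 Prop. 3, Ch. XI §1 (iv)] -/
theorem localInv_ideleConj (v' : HeightOneSpectrum (𝓞 K)) (c : groupCohomology (IdeleClassGroup.ideleRep K E) 2) :
    haveI : IsGalois K E := IsGalois.tower_top_of_isGalois F K E
    localInv E v' (ideleConj F K E t 2 c) = localInv E ((t.restrictNormal K)⁻¹ • v') c := by
  haveI : IsGalois K E := IsGalois.tower_top_of_isGalois F K E
  have h₀ : t.restrictNormal K • ((t.restrictNormal K)⁻¹ • v') = v' := smul_inv_smul _ _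
  obtain ⟨w₀⟩ := (Place.nonempty : Nonempty (Place K E ((t.restrictNormal K)⁻¹ • v')))
  rw [localInv_eq_localInvAt (galSmulPlace t h₀ w₀), localInv_eq_localInvAt w₀]
  exact localInvAt_ideleConj t h₀ w₀ (galSmulPlace t h₀ w₀) rfl c

end Main

/-! ## §5. Bridge to the subgroup currency: `conjRepCohomology N J_E` on `Hⁿ(N, J_E)` for `N ≤ Gal(E/F)` with `N ≃ Gal(E/K)` -/

section Subgroup

variable {F K E : Type} [Field F] [Field K] [Field E] [NumberField E] [Algebra F K] [Algebra K E] [Algebra F E]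
  [IsScalarTower F K E] [Normal F K] (N : Subgroup (E ≃ₐ[F] E)) (e : N ≃* (E ≃ₐ[K] E))
  (he : ∀ g : N, AlgEquiv.restrictScalars F (e g) = (g : E ≃ₐ[F] E))

/-- **`Hⁿ(N, J_E) ≅ Hⁿ(Gal(E/K), J_E)` along `e : N ≃ Gal(E/K)` compatible with the inclusions into `Gal(E/F)`** (Mathlib
`groupCohomology.mapIso`; instance: `K = E^N`, `e = fixingSubgroupEquiv`, the tree's `groupCohomologyResIdeleRepIso`).
[cite: CasselsFrohlichANT1967, Ch. VII §7.3] -/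
def resIdeleRepIsoOfEquiv (n : ℕ) :
    groupCohomology (Rep.res N.subtype (IdeleClassGroup.ideleRep F E)) n ≅ groupCohomology (IdeleClassGroup.ideleRep K E) n :=
  groupCohomology.mapIso e (LinearEquiv.refl ℤ _) (fun g => LinearMap.ext fun x => by
    change (IdeleClassGroup.ideleRep F E).ρ (g : E ≃ₐ[F] E) x =
      (IdeleClassGroup.ideleRep F E).ρ (AlgEquiv.restrictScalars F (e g)) x
    rw [he]) n

/-- **The bridge**: under `Hⁿ(N, J_E) ≅ Hⁿ(Gal(E/K), J_E)` the tree's `conjRepCohomology N J_E n t` IS `ideleConj F K E t n`.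
[cite: SerreLocalFields1979, Ch. VII §5][cite: Brown1982CohomologyGroups, III (8.3)] -/
theorem resIdeleRepIsoOfEquiv_conjRepCohomology [N.Normal] (t : E ≃ₐ[F] E) (n : ℕ)
    (z : groupCohomology (Rep.res N.subtype (IdeleClassGroup.ideleRep F E)) n) :
    (resIdeleRepIsoOfEquiv N e he n).hom (conjRepCohomology N (IdeleClassGroup.ideleRep F E) n t z) =
      ideleConj F K E t n ((resIdeleRepIsoOfEquiv N e he n).hom z) := by
  have key : groupCohomology.map (subgroupConj N t (conj_mem_of_normal N t))
        (resConj N (IdeleClassGroup.ideleRep F E) t (conj_mem_of_normal N t)) n ≫ (resIdeleRepIsoOfEquiv N e he n).hom =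
      (resIdeleRepIsoOfEquiv N e he n).hom ≫ ideleConj F K E t n := by
    rw [resIdeleRepIsoOfEquiv, groupCohomology.mapIso_hom, ideleConj, ← groupCohomology.map_comp,
      ← groupCohomology.map_comp]
    refine map_congr' ?_ _ _ (fun x => ?_) n
    · refine MonoidHom.ext fun g => Subtype.ext ?_
      change t⁻¹ * ((e.symm g : N) : E ≃ₐ[F] E) * t = ((e.symm (galConjOver K t g) : N) : E ≃ₐ[F] E)
      rw [← he (e.symm g), ← he (e.symm (galConjOver K t g)), MulEquiv.apply_symm_apply, MulEquiv.apply_symm_apply,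
        restrictScalars_galConjOver]
    · rfl
  simpa only [ModuleCat.hom_comp, LinearMap.comp_apply, conjRepCohomology_apply] using congrArg (fun φ => φ.hom z) key

variable [NumberField K] [IsGalois F E]

/-- **(θ-ii) in the subgroup currency**: `localInv E v' (σ_t z) = localInv E ((t|_K)⁻¹ v') z` for the tree's
`σ_t = conjRepCohomology N J_E 2 t` read through `Hⁿ(N, J_E) ≅ Hⁿ(Gal(E/K), J_E)`.
[cite: CasselsFrohlichANT1967, Ch. VII §1.1, §7.2–§7.3][cite: SerreLocalFields1979, Ch. VII §5 Prop. 3] -/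
theorem localInv_conjRepCohomology [N.Normal] (t : E ≃ₐ[F] E) (v' : HeightOneSpectrum (𝓞 K))
    (z : groupCohomology (Rep.res N.subtype (IdeleClassGroup.ideleRep F E)) 2) :
    haveI : IsGalois K E := IsGalois.tower_top_of_isGalois F K E
    localInv E v' ((resIdeleRepIsoOfEquiv N e he 2).hom (conjRepCohomology N (IdeleClassGroup.ideleRep F E) 2 t z)) =
      localInv E ((t.restrictNormal K)⁻¹ • v') ((resIdeleRepIsoOfEquiv N e he 2).hom z) := by
  rw [resIdeleRepIsoOfEquiv_conjRepCohomology]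
  exact localInv_ideleConj t v' _

end Subgroup


end IdeleCohomology

end Literature.NumberTheory.GaloisRepresentations

end
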